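import Mathlib.Algebra.MvPolynomial.CommRing
import Mathlib.Algebra.MvPolynomial.Eval
import Mathlib.RingTheory.Ideal.Maps
import Mathlib.Data.Finset.Powerset
import Mathlib.Order.Interval.Finset.Nat
import Mathlib.Data.Nat.Choose.Basic
import HarnessLib

/-!
# Hu 2025 (arXiv:2507.21400v1) §3.1–§3.3 = PDF §3a–§3c, chunks p0016 l.26 – p0018 l.73 (PDF p.32 l.22 – p.39 l.18) — the PLATFORM
# (interface I-PL, PARTITION-HU row 101a): `𝕀_{3,n}`, the Plücker variables, the chart `𝕌 = (p₁₂₃ ≡ 1)`,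
# `𝕀^lt_{3,n}`, `Υ`, the Plücker relations `F_{h,k}` and `I_℘`, the (de-homogenised) m-primary relations
# `F_{m,u}` / `F̄_{m,u}` with their TERMS, `𝓕_m`, `I_{℘,m}`, the basic variables `Var_𝕌`, the bundle `HuPlatform`
# STATEMENTS-FIRST typing (rung M-Hu-min of LADDER-RESOLUTION, D-0089)

**Status of the source (D-0012): UNREFEREED PREPRINT UNDER ADJUDICATION.** Y. Hu, *Universal Characteristic-free
Resolution of Singularities, I*, arXiv:2507.21400v1 (2025), 162 pp. [Hu2025] (lit key `paper:arxiv-2507.21400`; text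
of record = the TeX chunks `p00CC.txt`; locators «chunk pCC l.a–b» read on the chunk; «PDF p.N l.a–b» read on the per-page PDF
text `lit/res-lit-6/hu25/text/hu25_pNNN.txt` (the PDF prints the sections as §3a–§3e and numbers the displays (3.1)–(3.19);
both the TeX label and the PDF number are given). HONEST CEILING (PARTITION-HU header): Part I as printed claims resolution of singularity
TYPES; the summit-type claim rests on the unposted Part II. Nothing from the preprint is asserted here: printed
DEFINITIONS are real Lean definitions over Mathlib carriers, printed CLAIMS are `def … : Prop` candidates
`[claim: Hu2025, status: under-review]`. No proofs, no `sorry`, no `instance`, no notation. AI typing is weaker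
than expert review.

## Carrier choices (PARTITION-HU §1 «chart-local commutative algebra»; §1c anchors)
* **No index shift.** `[n] = {1,…,n}` (chunk p0016 l.30–31) is used LITERALLY: an element of `𝕀_{3,n}` (l.32–37, «the set
  of all sequences of distinct integers {1 ≤ u₁ < u₂ < u₃ ≤ n} … also regard[ed] … as a subset of 3 distinct integers
  in [n]») is an increasing TRIPLE `(u₁, u₂, u₃) : ℕ × ℕ × ℕ` with `1 ≤ u₁ < u₂ < u₃ ≤ n` (`plIndex n`, a finite type;
  `triSet` is the subset it is «also regarded as»), and every index in a printed formula (`x_{12u}`, `(123)`,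
  `3 < u < v ≤ n`) is typed with the printed numerals — no `Fin`, no shift, no sorting inside the primary relations
  (all their indices are printed increasingly). The chart index `m = (123)` (chunk p0017 l.14–17 «Up to permutation, it
  suffices to assume m = (123)»; fixed for the rest of the paper, chunk p0020 l.9–11) is the CONSTANT `mTri = (1,2,3)`
  (`mSet = {1,2,3}`), not a parameter.
* The homogeneous coordinate ring `ℤ[p_u]_{u ∈ 𝕀_{3,n}}` of `ℙ(∧³E)` (chunk p0017 l.1–2; `E_α` «of dimension 1 over 𝕜
  (or, a free module of rank 1 over ℤ)», p0016 l.43) = `PlRing n k := MvPolynomial (plIndex n) k` over an arbitrary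
  commutative ring `k` (explicit binder of every decl; `ℤ`, `𝕜` are instances). The conventions (signConvention)
  «p_{σ(u₁)σ(u₂)σ(u₃)} = sgn(σ) p_{u₁u₂u₃}» and «p_u := 0 if u_i = u_j» (p0016 l.86–105) are implemented by the SIGNED
  LOOKUP `pCoord k a b c` of an arbitrary index sequence (`sort3`, `inv3`); for an increasing triple the lookup is `pTri`.
* The chart ring `𝕜[x_u]_{u ∈ 𝕀_{3,n} ∖ m}` (Def 3.5, chunk p0018 l.62–65) = `ChartRing n k := MvPolynomial (plVar n) k`
  with `plVar n = ↥(𝕀_{3,n}.erase m)`; «set p_m = 1 and let x_u = p_u» (p0017 l.25, p0018 l.45, l.69–70) = the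
  lookup `xbar` (value `1` at `m`) and the `k`-algebra map `dehomog`.
* The m-primary relations are typed from the FOUR EXPLICIT printed forms (chunk p0017 l.116–130 homogeneous;
  p0018 l.17–33 and p0020 l.22–32 de-homogenised) as TERM LISTS `primaryTerms u` (display (p0018 l.38–44):
  «F = Σ_{s ∈ S_F} sgn(s) p_{u_s} p_{v_s} = sgn(s_F) p_m p_{u_{s_F}} + …», leading term FIRST), from which `primaryRel`
  (`F_{m,u}`, Def 3.3) and `primaryRelBar` (`F̄_{m,u}`, Def 3.4) are the sums; row 102 (I-ORD) reads `S_F`, `sgn(s)`,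
  `(u_s, v_s)` off the same lists. The compact recipe (keyTrick1)–(keyTrick3) (p0017 l.79–114, «h = (u₂u₃) and k = (u123)», read `k = (u₁123)`)
  is typed separately in R101b (AS PRINTED, with its `_ours` sibling) — see the READING NOTE there.
* TREE ANCHOR (PARTITION-HU §1c; cited, not imported, nothing re-declared): the Grassmannian with Plücker coordinates
  exists as `Literature.AlgebraicGeometry.Motives.FanoPlanes.grassmannian 2 (n-1) k` (file
  `Motives/FanoSchemeOfPlanes.lean`: ORDERED multi-indices `Fin 3 → Fin n`, `pl`, `plueckerRel`, `alternationRel`,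
  `repetitionRel`, `grassmannEquations`); Hu's `F_{h,k}` (pluckerEq) is `FanoPlanes.plueckerRel 2 (n-1) k (h, k)` read
  through the signed dictionary `pl I ↦ pCoord k (I 0 + 1) (I 1 + 1) (I 2 + 1)`. The scheme-level objects (`Gr^{3,E}`,
  `𝕌 ∩ Gr^{3,E}` as schemes) belong to row 110; this file stays at the polynomial-ring level (the binding carrier).
* NOT in this file (row 101b = `R101bPrimary.lean`): Prop 3.6, Prop 3.8, the claims «|𝕀^lt| = Υ» (C17L64) and
  «𝕀^lt ↔ 𝓕_m is a bijection» (C18L15), the (keyTrick) sic pair, Ex 3.2, Rem 3.10; Ex 3.9 concerns `Gr(2,5)` (outside the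
  `Gr^{3,E}` platform — index only). §3.4–§3.5 (orders, `S_F` bookkeeping) = row 102.

JUNK VALUES (CONVENTIONS §4, documented): `pTri`/`pCoord`/`xbar` return `0` on a triple that is not an increasing triple
in `[n]` (resp. not sortable to one); `primaryTerms u = []` (so `F_{m,u} = 0`) for `u ∉ 𝕀^lt_{3,n}`; `plRel` is typed for
arbitrary index sequences (the printed `F_{h,k}` is the case `h₁ < h₂`, `k₁ < k₂ < k₃ < k₄` in `[n]`); `rkF` uses truncated
subtraction (`𝔱_F − 2` with `𝔱_F = 3 − |h ∩ k|`; for `|h ∩ k| = 2` the expression `F_{h,k}` is identically `0`, «not a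
Plücker relation» p0016 l.121, and `rkF = 0` is junk). `IsLt`, `Upsilon`, `mTri` are meaningful for `n > 3` only (the
standing hypothesis, bundled as `HuPlatform n`).
-/

noncomputable section

namespace Literature.AlgebraicGeometry.Hu2025.Statements.S03Pluecker

open MvPolynomial

universe u

/-! ## §3.1 (PDF §3a), chunk p0016 l.30–37 (PDF p.32 l.23–28): `[n]`, `𝕀_{3,n}`; the standing hypothesis `n > 3` -/

/-- **`𝕀_{3,n}` as a finite set of increasing triples** (chunk p0016 l.32–36; PDF p.32 l.23–26): «We let 𝕀_{3,n} be the set of all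
sequences of distinct integers {1 ≤ u₁ < u₂ < u₃ ≤ n}. An element of 𝕀_{3,n} is frequently written as u = (u₁u₂u₃).»
(NO index shift; `t = (u₁, (u₂, u₃))`.) [claim: Hu2025, status: under-review]
STATUS: candidate statement under adjudication (D-0012/D-0089); not asserted. -/
def plIndexSet (n : ℕ) : Finset (ℕ × ℕ × ℕ) :=
  (Finset.Icc 1 n ×ˢ Finset.Icc 1 n ×ˢ Finset.Icc 1 n).filter fun t => t.1 < t.2.1 ∧ t.2.1 < t.2.2

/-- **`𝕀_{3,n}`, the index TYPE** (chunk p0016 l.32–37; PDF p.32 l.23–26) = `↥(plIndexSet n)`: `u : plIndex n` has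
`u.1 = (u₁, u₂, u₃) : ℕ × ℕ × ℕ` and `u.2 : u.1 ∈ plIndexSet n` (i.e. `1 ≤ u₁ < u₂ < u₃ ≤ n`, by `Finset.mem_filter`,
`Finset.mem_product`, `Finset.mem_Icc`). PARTITION name `plIndex`. [claim: Hu2025, status: under-review]
STATUS: candidate statement under adjudication (D-0012/D-0089); not asserted. -/
abbrev plIndex (n : ℕ) : Type := ↥(plIndexSet n)

/-- «We also regard an element of 𝕀_{3,n} as a subset of 3 distinct integers in [n]» (chunk p0016 l.37–39; PDF p.32 l.26–28): the index
SET `{u₁, u₂, u₃}` of a triple (used for `u ∖ m`, `u ∩ m`, `|u ∖ m|`). [claim: Hu2025, status: under-review]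
STATUS: candidate statement under adjudication (D-0012/D-0089); not asserted. -/
def triSet (u : ℕ × ℕ × ℕ) : Finset ℕ := {u.1, u.2.1, u.2.2}

/-- **The standing data of §3 ff., bundled** (PARTITION-HU §1 `HuPlatform n`): chunk p0016 l.30 (PDF p.32 l.23) «Fix any positive
integer n > 3» (so `m = (123) ∈ 𝕀_{3,n}` and `[n] ∖ [3] ≠ ∅`). The other standing conventions are DEFINITIONS, not data:
the chart index `m = (123)` is the constant `mTri`/`mSet` (chunk p0017 l.14–17 = PDF p.35 l.4–5; p0020 l.9–11 = PDF p.43 l.4–5 «Throughout the remainder of this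
paper, we will focus on Gr^{3,E} ⊂ ℙ(∧³E) and the chart 𝕌 = (p₁₂₃ ≡ 1)»), and the base ring `𝕜`/`ℤ` (chunk p0016
l.43; PDF p.32 l.30) is the explicit binder `(k) [CommRing k]` of each decl. Later rows take `(P : HuPlatform n)`.
[claim: Hu2025, status: under-review]
STATUS: candidate statement under adjudication (D-0012/D-0089); not asserted. -/
structure HuPlatform (n : ℕ) : Prop where
  /-- chunk p0016 l.30 (PDF p.32 l.23): «Fix any positive integer n > 3.» -/
  three_lt : 3 < n

/-- **The chart index `m = (123)`** (chunk p0017 l.14–17 = PDF p.35 l.4–5 «we focus on a fixed affine chart (p_m ≠ 0) … Up to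
permutation, it suffices to assume m = (123)»; p0018 l.73 = PDF p.38 l.10 «Recall that we always set m = (123)») — the constant triple `(1,2,3)`.
[claim: Hu2025, status: under-review]
STATUS: candidate statement under adjudication (D-0012/D-0089); not asserted. -/
def mTri : ℕ × ℕ × ℕ := (1, 2, 3)

/-- The chart index `m = (123)` regarded as a subset (chunk p0017 l.47 = PDF p.35 l.26 «u and m are also regarded as subsets of
integers»): `{1,2,3}` (`= triSet mTri`). [claim: Hu2025, status: under-review]
STATUS: candidate statement under adjudication (D-0012/D-0089); not asserted. -/
def mSet : Finset ℕ := {1, 2, 3}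

/-! ## §3.1 (PDF §3a), chunk p0016 l.86–131 and p0017 l.1–4 (PDF p.33 l.25 – p.34 l.33): `k[p_u]`, the sign conventions
(3.1)/(3.2), `F_{h,k}` (3.3), `I_℘` -/

/-- **The homogeneous coordinate ring `k[p_u]_{u ∈ 𝕀_{3,n}}` of `ℙ(∧³E)`** (chunk p0017 l.1–2 = PDF p.34 l.28–29, printed over `ℤ`;
here over the binder `k`). [claim: Hu2025, status: under-review]
STATUS: candidate statement under adjudication (D-0012/D-0089); not asserted. -/
abbrev PlRing (n : ℕ) (k : Type u) [CommRing k] : Type u := MvPolynomial (plIndex n) k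

/-- **`p_t` for an INCREASINGLY written index triple `t = (a,b,c)`**: the variable `p_t` if `1 ≤ a < b < c ≤ n`, else `0`
(junk; covers «p_u := 0 if u_i = u_j», chunk p0016 l.98–105 = PDF eq. (3.2), p.33 l.31–34). Plumbing. [claim: Hu2025, status: under-review]
STATUS: candidate statement under adjudication (D-0012/D-0089); not asserted. -/
def pTri {n : ℕ} (k : Type u) [CommRing k] (t : ℕ × ℕ × ℕ) : PlRing n k :=
  if h : t ∈ plIndexSet n then X ⟨t, h⟩ else 0

/-- The number of inversions of the index sequence `(a, b, c)` (the sign of the sorting permutation is `(−1)^{inv3}`;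
plumbing for (signConvention) = PDF eq. (3.1), chunk p0016 l.86–97, PDF p.33 l.25–30). [claim: Hu2025, status: under-review]
STATUS: candidate statement under adjudication (D-0012/D-0089); not asserted. -/
def inv3 (a b c : ℕ) : ℕ :=
  (if b < a then 1 else 0) + (if c < a then 1 else 0) + (if c < b then 1 else 0)

/-- The increasing rearrangement of the index sequence `(a, b, c)` (a three-element sorting network; plumbing for
(signConvention) = PDF eq. (3.1), chunk p0016 l.86–97, PDF p.33 l.25–30). [claim: Hu2025, status: under-review]
STATUS: candidate statement under adjudication (D-0012/D-0089); not asserted. -/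
def sort3 (a b c : ℕ) : ℕ × ℕ × ℕ :=
  let x := min a b
  let y := max a b
  (min x c, min (max x c) y, max y c)

/-- **The signed Plücker coordinate `p_{abc}` of an ARBITRARY index sequence** (chunk p0016 l.86–105 = PDF eqs. (3.1)/(3.2), p.33 l.25–34): «p_{u₁u₂u₃} is
defined for any sequence of d [sic: d = 3] distinct integers between 1 and n, not necessarily listed in the sequential
order … subject to the relation p_{σ(u₁)σ(u₂)σ(u₃)} = sgn(σ) p_{u₁u₂u₃}» and «p_u := 0 … if u_i = u_j for some i ≠ j»:
the variable of the sorted triple `sort3 a b c` with the sign `(−1)^{inv3 a b c}` of the sorting permutation, `0` on a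
repeated or out-of-range index. [claim: Hu2025, status: under-review]
STATUS: candidate statement under adjudication (D-0012/D-0089); not asserted. -/
def pCoord {n : ℕ} (k : Type u) [CommRing k] (a b c : ℕ) : PlRing n k :=
  (-1) ^ inv3 a b c * pTri k (sort3 a b c)

/-- **The Plücker relation `F_{h,k}`** (display (pluckerEq) = PDF eq. (3.3), chunk p0016 l.107–121, PDF p.34 l.3–8), for `h = {h₁, h₂} ∈ 𝕀_{2,n}`
and `k = {k₁, k₂, k₃, k₄} ∈ 𝕀_{4,n}` (elements listed increasingly): «F_{h,k} = p_{h₁h₂k₁} p_{k₂k₃k₄}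
− p_{h₁h₂k₂} p_{k₁k₃k₄} + p_{h₁h₂k₃} p_{k₁k₂k₄} − p_{h₁h₂k₄} p_{k₁k₂k₃}. It is called a Plücker relation if it is not
identically zero.» Typed for arbitrary index sequences `h = (h₁h₂)`, `k = (k₁k₂k₃k₄)` through the signed lookup (the
printed case is `h₁ < h₂`, `k₁ < ⋯ < k₄` in `[n]`; out-of-range or repeated indices give `0` factors). TREE ANCHOR:
`Motives.FanoPlanes.plueckerRel 2 (n-1) k` is the same alternating sum over ORDERED indices.
[claim: Hu2025, status: under-review]
STATUS: candidate statement under adjudication (D-0012/D-0089); not asserted. -/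
def plRel {n : ℕ} (k : Type u) [CommRing k] (h₁ h₂ k₁ k₂ k₃ k₄ : ℕ) : PlRing n k :=
  pCoord k h₁ h₂ k₁ * pCoord k k₂ k₃ k₄ - pCoord k h₁ h₂ k₂ * pCoord k k₁ k₃ k₄
    + pCoord k h₁ h₂ k₃ * pCoord k k₁ k₂ k₄ - pCoord k h₁ h₂ k₄ * pCoord k k₁ k₂ k₃

/-- **The ideal `I_℘`** (chunk p0017 l.1–4; PDF p.34 l.28–30): «I_℘ ⊂ ℤ[p_u] … the homogeneous ideal generated by all the Plücker
relations (pluckerEq) [PDF: (3.3)] or (succinct-pl) [(3.4)]», `(h, k) ∈ 𝕀_{2,n} × 𝕀_{4,n}` (p0016 l.107–110: `h = {h₁, h₂}`, `k = {k₁, k₂, k₃, k₄}` increasing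
in `[n]`). (p0017 l.5–8 = PDF p.34 l.30–33: the full homogeneous ideal `I_℘̂` of `Gr^{3,E}` is said to be larger «over ℤ, or a field of
positive characteristic, in general» — recorded, NOT typed here.) [claim: Hu2025, status: under-review]
STATUS: candidate statement under adjudication (D-0012/D-0089); not asserted. -/
def IPl (n : ℕ) (k : Type u) [CommRing k] : Ideal (PlRing n k) :=
  Ideal.span {F | ∃ h₁ h₂ k₁ k₂ k₃ k₄ : ℕ, 1 ≤ h₁ ∧ h₁ < h₂ ∧ h₂ ≤ n ∧
    1 ≤ k₁ ∧ k₁ < k₂ ∧ k₂ < k₃ ∧ k₃ < k₄ ∧ k₄ ≤ n ∧ F = plRel k h₁ h₂ k₁ k₂ k₃ k₄}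

/-- **Definition 3.1, `𝔱_F`** (chunk p0016 l.135–142; PDF p.34 l.18–22): for `F = F_{h,k}`, «We let 𝔱_F + 1 be the number of terms
in F (which assumes values 3 or 4)» — the number of non-vanishing terms of (pluckerEq) is `4 − |h ∩ k|` (the term
`± p_{h₁h₂k_i} p_{…}` vanishes iff `k_i ∈ h`), so `𝔱_F = 3 − |h ∩ k|` («assumes values 2 or 3», l.141), `h`, `k` as sets.
[claim: Hu2025, status: under-review]
STATUS: candidate statement under adjudication (D-0012/D-0089); not asserted. -/
def tF (h₁ h₂ k₁ k₂ k₃ k₄ : ℕ) : ℕ := 3 - (({h₁, h₂} : Finset ℕ) ∩ {k₁, k₂, k₃, k₄}).card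

/-- **Definition 3.1, the rank `rk(F) := 𝔱_F − 2`** (chunk p0016 l.139–142; PDF p.34 l.19–22 «assumes values 0 or 1»; the PDF
writes `rank (F)` for the chunk's `rk (F)`). Truncated
subtraction; junk `0` when `|h ∩ k| = 2` (then `F_{h,k} ≡ 0` is not a Plücker relation). [claim: Hu2025, status: under-review]
STATUS: candidate statement under adjudication (D-0012/D-0089); not asserted. -/
def rkF (h₁ h₂ k₁ k₂ k₃ k₄ : ℕ) : ℕ := tF h₁ h₂ k₁ k₂ k₃ k₄ - 2

/-- Numbered alias **`Def3_1`** = `rkF` (Def 3.1 defines the pair `𝔱_F`, `rk(F) = 𝔱_F − 2`: `tF`, `rkF`).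
[claim: Hu2025, status: under-review]
STATUS: candidate statement under adjudication (D-0012/D-0089); not asserted. -/
abbrev Def3_1 (h₁ h₂ k₁ k₂ k₃ k₄ : ℕ) : ℕ := rkF h₁ h₂ k₁ k₂ k₃ k₄

/-! ## §3.2 (PDF §3b), chunk p0017 l.10–68 (PDF p.35): the chart `𝕌 = (p_m ≡ 1)`, `Υ`, `𝕀^lt_{3,n}` (3.5) -/

/-- **`Υ := C(n,3) − 1 − 3(n−3)`** (chunk p0017 l.34; PDF p.35 l.13–18), the number of m-primary Plücker relations. (Truncated
subtraction; meaningful for `n > 3`.) [claim: Hu2025, status: under-review]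
STATUS: candidate statement under adjudication (D-0012/D-0089); not asserted. -/
def Upsilon (n : ℕ) : ℕ := n.choose 3 - 1 - 3 * (n - 3)

/-- **`𝕀^lt_{3,n}`** (display (Ilt) = PDF eq. (3.5), chunk p0017 l.43–50, PDF p.35 l.22–30): «𝕀^lt_{3,n} = {u ∈ 𝕀_{3,n} ∣ |u ∖ m| ≥ 2}» where
«|u ∖ m| denotes the cardinality of u ∖ m» («lt stands for leading term»); explicitly (l.54–56; PDF p.35 l.32–33)
«{(1uv), (2uv), (3uv), (abc) ∣ 3 < u < v ≤ n, 3 < a < b < c ≤ n}». Typed literally on triples via `triSet` (an `abbrev`,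
so that `IsLt u` is decidable by unfolding). [claim: Hu2025, status: under-review]
STATUS: candidate statement under adjudication (D-0012/D-0089); not asserted. -/
abbrev IsLt (u : ℕ × ℕ × ℕ) : Prop := 2 ≤ (triSet u \ mSet).card

/-- **The Plücker variables `x_u`, `u ∈ 𝕀_{3,n} ∖ m`, of the chart `𝕌 = (p_m ≡ 1)`** (chunk p0017 l.18–26; PDF p.35 l.8–10: «the
affine space 𝕌 comes equipped with the local free variables x_u = p_u/p_m for all u ∈ 𝕀_{3,n} ∖ m. In practical
calculations, we will simply set p_m = 1»; p0020 l.13–17 = PDF p.43 l.6–8): the finite index SET `𝕀_{3,n} ∖ {m}` of the variables.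
[claim: Hu2025, status: under-review]
STATUS: candidate statement under adjudication (D-0012/D-0089); not asserted. -/
def plVarSet (n : ℕ) : Finset (ℕ × ℕ × ℕ) := (plIndexSet n).erase mTri

/-- **The Plücker variables `x_u`, `u ∈ 𝕀_{3,n} ∖ m` — the index TYPE** `↥(plVarSet n)` (chunk p0017 l.18–26; PDF p.35 l.8–10; `x : plVar n`
has `x.1 : ℕ × ℕ × ℕ`, `x.2 : x.1 ∈ plVarSet n`, i.e. `x.1 ≠ (1,2,3) ∧ x.1 ∈ 𝕀_{3,n}` by `Finset.mem_erase`). PARTITION name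
`plVar`. [claim: Hu2025, status: under-review]
STATUS: candidate statement under adjudication (D-0012/D-0089); not asserted. -/
abbrev plVar (n : ℕ) : Type := ↥(plVarSet n)

/-- **The coordinate ring `𝕜[x_u]_{u ∈ 𝕀_{3,n} ∖ m}` of the chart `𝕌`** (Def 3.5, chunk p0018 l.62–65 = PDF p.38 l.6–7 «we can identify the
coordinate ring of 𝕌 with 𝕜[x_u]_{u ∈ 𝕀_{3,n} ∖ m}»). [claim: Hu2025, status: under-review]
STATUS: candidate statement under adjudication (D-0012/D-0089); not asserted. -/
abbrev ChartRing (n : ℕ) (k : Type u) [CommRing k] : Type u := MvPolynomial (plVar n) k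

/-- **`x̄_t`, the chart value of the coordinate of an increasing triple `t = (a,b,c)`**: `1` for `t = m = (1,2,3)` («we will
simply set p_m = 1», chunk p0017 l.25 = PDF p.35 l.9–10), the variable `x_t` for `t ∈ 𝕀_{3,n} ∖ m`, and `0` otherwise (junk). Plumbing.
[claim: Hu2025, status: under-review]
STATUS: candidate statement under adjudication (D-0012/D-0089); not asserted. -/
def xbar {n : ℕ} (k : Type u) [CommRing k] (t : ℕ × ℕ × ℕ) : ChartRing n k :=
  if t = mTri then 1 else if h : t ∈ plVarSet n then X ⟨t, h⟩ else 0

/-- **De-homogenisation** «setting p_m = 1 and letting x_u = p_u for all u ∈ 𝕀_{3,n} ∖ m» (chunk p0018 l.45, l.69–70 = PDF p.37 l.49–50,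
p.38 l.8; Def 3.5), as the `k`-algebra map `k[p_u] → k[x_u]`, `p_u ↦ x̄_u`. [claim: Hu2025, status: under-review]
STATUS: candidate statement under adjudication (D-0012/D-0089); not asserted. -/
def dehomog (n : ℕ) (k : Type u) [CommRing k] : PlRing n k →ₐ[k] ChartRing n k :=
  aeval fun u : plIndex n => xbar k u.1

/-- **`I_{℘,m}`, the de-homogenised Plücker ideal** (Def 3.5, chunk p0018 l.67–72; PDF p.38 l.7–9): «the ideal of 𝕜[x_u] obtained
from the ideal I_℘ by setting p_m = 1 and letting x_u = p_u … the de-homogenization of the homogeneous Plücker ideal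
I_℘ on the chart 𝕌» — the image ideal under `dehomog`. [claim: Hu2025, status: under-review]
STATUS: candidate statement under adjudication (D-0012/D-0089); not asserted. -/
def IPlChart (n : ℕ) (k : Type u) [CommRing k] : Ideal (ChartRing n k) := (IPl n k).map (dehomog n k)

/-- Numbered alias **`Def3_5`** = `IPlChart` (Def 3.5 also sets «𝔱_{F̄} = 𝔱_F and rk(F̄) = rk(F)», chunk p0018 l.60 = PDF p.38 l.5,
carried by `tF`/`rkF`, and identifies the coordinate ring of `𝕌` = `ChartRing`). [claim: Hu2025, status: under-review]
STATUS: candidate statement under adjudication (D-0012/D-0089); not asserted. -/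
abbrev Def3_5 (n : ℕ) (k : Type u) [CommRing k] : Ideal (ChartRing n k) := IPlChart n k

/-! ## §3.2–§3.3 (PDF §3b–§3c), chunk p0017 l.116–139, p0018 l.1–55 (PDF p.36 l.33 – p.38 l.3): the m-primary relations
(3.8)–(3.15) and their terms -/

/-- **A term `sgn(s) p_{u_s} p_{v_s}` of an m-primary Plücker relation** (display chunk p0018 l.38–44 = PDF eq. (3.14),
p.37 l.40–49: «F = Σ_{s ∈ S_F} sgn(s) p_{u_s} p_{v_s} = sgn(s_F) p_m p_{u_{s_F}} + Σ_{s ∈ S_F ∖ s_F} sgn(s) p_{u_s} p_{v_s} where s_F is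
the index for the leading term of F»): a sign and the two index triples, recorded AS WRITTEN (increasingly) in the
explicit forms (for the leading term `u_s = u`, `v_s = m`). Plumbing structure; row 102 reads `S_F`, `sgn(s)`,
`(u_s, v_s)` off it. [claim: Hu2025, status: under-review]
STATUS: candidate statement under adjudication (D-0012/D-0089); not asserted. -/
structure PlTerm where
  /-- the sign `sgn(s) ∈ {1, −1}` -/
  sgn : ℤ
  /-- the first index triple `u_s` as printed -/
  us : ℕ × ℕ × ℕ
  /-- the second index triple `v_s` as printed (`= m = (1,2,3)` for the leading term) -/
  vs : ℕ × ℕ × ℕ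

/-- **The terms of the m-primary relation `F_{(123),u}`, `u ∈ 𝕀^lt_{3,n}`, LEADING TERM FIRST**, read off the four
explicit printed forms (chunk p0017 l.116–130 = PDF p.36 l.33–38; = p0018 l.17–33 = PDF (3.10)–(3.13) p.37 l.30–39 and
p0020 l.24–32 = PDF (3.16) p.43 l.11–17 with `p_{123} = 1`):
«F_{(123),1uv} = p₁₂₃p_{1uv} − p_{12u}p_{13v} + p_{13u}p_{12v}», «F_{(123),2uv} = p₁₂₃p_{2uv} − p_{12u}p_{23v} +
p_{23u}p_{12v}», «F_{(123),3uv} = p₁₂₃p_{3uv} − p_{13u}p_{23v} + p_{23u}p_{13v}» («u < v ∈ [n] ∖ {1,2,3}»; the bound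
letters are `a < b` below) and «F_{(123),abc} = p₁₂₃p_{abc} − p_{12a}p_{3bc} + p_{13a}p_{2bc} − p_{23a}p_{1bc}»
(«a < b < c ∈ [n] ∖ {1,2,3}»). For an increasing triple `u = (u₁, u₂, u₃) ∈ 𝕀^lt_{3,n}` the case is read off `u₁`
(`u₁ = 1, 2, 3`: the forms `(1uv), (2uv), (3uv)` with `u ↦ u₂`, `v ↦ u₃`; `u₁ > 3`: the form `(abc) = (u₁u₂u₃)`); `[]` off
`𝕀^lt_{3,n}` (junk). [claim: Hu2025, status: under-review]
STATUS: candidate statement under adjudication (D-0012/D-0089); not asserted. -/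
def primaryTerms (u : ℕ × ℕ × ℕ) : List PlTerm :=
  if IsLt u then
    if u.1 = 1 then [⟨1, u, mTri⟩, ⟨-1, (1, 2, u.2.1), (1, 3, u.2.2)⟩, ⟨1, (1, 3, u.2.1), (1, 2, u.2.2)⟩]
    else if u.1 = 2 then [⟨1, u, mTri⟩, ⟨-1, (1, 2, u.2.1), (2, 3, u.2.2)⟩, ⟨1, (2, 3, u.2.1), (1, 2, u.2.2)⟩]
    else if u.1 = 3 then [⟨1, u, mTri⟩, ⟨-1, (1, 3, u.2.1), (2, 3, u.2.2)⟩, ⟨1, (2, 3, u.2.1), (1, 3, u.2.2)⟩]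
    else [⟨1, u, mTri⟩, ⟨-1, (1, 2, u.1), (3, u.2.1, u.2.2)⟩, ⟨1, (1, 3, u.1), (2, u.2.1, u.2.2)⟩,
      ⟨-1, (2, 3, u.1), (1, u.2.1, u.2.2)⟩]
  else []

/-- **The m-primary Plücker relation `F_{m,u}`** (Def 3.3, chunk p0017 l.133–139; PDF p.36 l.39–41: «We call the Plücker equation
F_{m,u} in (keyTrick4) [PDF: (3.8)] a primary Plücker equation for the chart 𝕌 = (p_m ≡ 1). We also say F_{m,u} is m-primary. The
term p_m p_u is called the leading term of F_{m,u}»), as the homogeneous quadric `Σ_s sgn(s) p_{u_s} p_{v_s}` of the term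
list `primaryTerms u` (whose head is the leading term). `0` off `𝕀^lt_{3,n}`. [claim: Hu2025, status: under-review]
STATUS: candidate statement under adjudication (D-0012/D-0089); not asserted. -/
def primaryRel (n : ℕ) (k : Type u) [CommRing k] (u : ℕ × ℕ × ℕ) : PlRing n k :=
  ((primaryTerms u).map fun t => (t.sgn : PlRing n k) * pTri k t.us * pTri k t.vs).sum

/-- Numbered alias **`Def3_3`** = `primaryRel` (the m-primary Plücker equation `F_{m,u}` with its leading term `p_m p_u`).
[claim: Hu2025, status: under-review]
STATUS: candidate statement under adjudication (D-0012/D-0089); not asserted. -/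
abbrev Def3_3 (n : ℕ) (k : Type u) [CommRing k] (u : ℕ × ℕ × ℕ) : PlRing n k := primaryRel n k u

/-- **The de-homogenised (localised) m-primary relation `F̄_{m,u}`** (display (equ:localized-uu) = PDF eq. (3.9), chunk p0017
l.161–168, PDF p.37 l.14–21, and Def 3.4 chunk p0018 l.1–7 = PDF p.37 l.22–25: «We call the relation (equ:localized-uu) [PDF:
(3.9)] the de-homogenized (or the localized) m-primary
Plücker relation corresponding to u ∈ 𝕀^lt_{3,n}. We call the unique distinguished variable, x_u, the leading variable»;
explicit forms p0018 l.17–33 = PDF (3.10)–(3.13), p.37 l.30–39: «F̄_{(123),1uv} = x_{1uv} − x_{12u}x_{13v} + x_{13u}x_{12v}», «F̄_{(123),2uv} = x_{2uv} −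
x_{12u}x_{23v} + x_{23u}x_{12v}», «F̄_{(123),3uv} = x_{3uv} − x_{13u}x_{23v} + x_{23u}x_{13v}», «F̄_{(123),abc} = x_{abc} −
x_{12a}x_{3bc} + x_{13a}x_{2bc} − x_{23a}x_{1bc}») = `Σ_s sgn(s) x̄_{u_s} x̄_{v_s}` with `x̄_m = 1` (display p0018
l.48–51 = PDF eq. (3.15), p.37 l.52 – p.38 l.3). The leading variable is `x̄_u = xbar k u`. [claim: Hu2025, status: under-review]
STATUS: candidate statement under adjudication (D-0012/D-0089); not asserted. -/
def primaryRelBar (n : ℕ) (k : Type u) [CommRing k] (u : ℕ × ℕ × ℕ) : ChartRing n k :=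
  ((primaryTerms u).map fun t => (t.sgn : ChartRing n k) * xbar k t.us * xbar k t.vs).sum

/-- Numbered alias **`Def3_4`** = `primaryRelBar` (the de-homogenised m-primary relation `F̄_{m,u}`, leading variable `x_u`).
[claim: Hu2025, status: under-review]
STATUS: candidate statement under adjudication (D-0012/D-0089); not asserted. -/
abbrev Def3_4 (n : ℕ) (k : Type u) [CommRing k] (u : ℕ × ℕ × ℕ) : ChartRing n k := primaryRelBar n k u

/-- **The set `𝓕_m = 𝓕_{(123)}` of all de-homogenised m-primary relations** (Def 3.4, chunk p0018 l.9–15; PDF p.37 l.26–29: «We let 𝓕_m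
be the set of all of the equations in (equ:localized-uu) [PDF: (3.9)]. Then, we have the correspondence 𝕀^lt_{3,n} ⟷ 𝓕_m,
u → F_{m,u}»; Prop 3.6 l.80 = PDF p.38 l.13 «𝓕 = {F̄_{(123),u} ∣ u ∈ 𝕀^{(123)}_{3,n}}»; p0020 l.44 = PDF p.43 l.23). [claim: Hu2025, status: under-review]
STATUS: candidate statement under adjudication (D-0012/D-0089); not asserted. -/
def primaryFamily (n : ℕ) (k : Type u) [CommRing k] : Set (ChartRing n k) :=
  {F | ∃ u : plIndex n, IsLt u.1 ∧ F = primaryRelBar n k u.1}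

/-! ## chunk p0018 l.144–151 (PDF p.39 l.19–23): the rank of a primary relation and `𝓕^r` -/

/-- **The rank of the m-primary relation `F_{m,u}`** («rank_m(F_{m,u})», chunk p0018 l.146–149, l.156 = PDF p.39 l.19–21, l.26; Def 3.1 `rk = 𝔱 − 2`
with `𝔱 + 1` = number of terms; Def 3.5 «rk(F̄) = rk(F)»): computed from the term list, `|primaryTerms u| − 3` (`0` for the
three-term forms `(1uv), (2uv), (3uv)`, `1` for `(abc)`; p0020 l.32 = PDF p.43 l.17 «The first three are of rank 0, the last is of rank 1»;
junk `0` off `𝕀^lt`). [claim: Hu2025, status: under-review]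
STATUS: candidate statement under adjudication (D-0012/D-0089); not asserted. -/
def rkPrimary (u : ℕ × ℕ × ℕ) : ℕ := (primaryTerms u).length - 3

/-- **`𝓕^r`** (chunk p0018 l.144–151; PDF p.39 l.19–23): «For r = 0 or 1, we let 𝓕^r = {F̄_{m,u} ∣ rank(F_{m,u}) = r, u ∈ 𝕀^lt_{3,n}} …
Hence 𝓕_m = 𝓕⁰ ⊔ 𝓕¹.» [claim: Hu2025, status: under-review]
STATUS: candidate statement under adjudication (D-0012/D-0089); not asserted. -/
def primaryFamilyRk (n : ℕ) (k : Type u) [CommRing k] (r : ℕ) : Set (ChartRing n k) :=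
  {F | ∃ u : plIndex n, IsLt u.1 ∧ rkPrimary u.1 = r ∧ F = primaryRelBar n k u.1}

/-! ## Def 3.7, chunk p0018 l.136–142 (PDF p.39 l.14–18): the m-basic variables `Var_𝕌` (also Prop 3.6, l.82–85 = PDF p.38 l.15–17) -/

/-- **Definition 3.7, as a predicate** (chunk p0018 l.136–140; PDF p.39 l.14–17): «We call the variables in Var_𝕌 := {x_u ∣ u ∈ 𝕀_{3,n}
∖ m ∖ 𝕀^lt_{3,n}} the m-basic Plücker variables, or simply basic variables» (l.142: «Only non-basic Plücker variables
correspond to m-primary Plücker equations»; by (p0017 l.61–62 = PDF p.35 l.34–36) these are the `x_{12u}, x_{13u}, x_{23u}`, `u ∈ [n] ∖ [3]`).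
[claim: Hu2025, status: under-review]
STATUS: candidate statement under adjudication (D-0012/D-0089); not asserted. -/
abbrev IsBasic {n : ℕ} (x : plVar n) : Prop := ¬ IsLt x.1

/-- **Definition 3.7, the set `Var_𝕌` of m-basic Plücker variables** (chunk p0018 l.136–140 = PDF p.39 l.14–17; = Prop 3.6 l.85 =
PDF p.38 l.16 «Var_𝕌 := {x_u ∣ u ∈ 𝕀_{3,n} ∖ {(123)} ∖ 𝕀^{(123)}_{3,n}}»). PRINTED-INCONSISTENCY POINTER (PARTITION-HU §6 (h), T5):
Def 7.1 (chunk p0057 l.9) re-uses the symbol `Var_𝕌` for ALL `x_u`, `u ≠ m`; that set is row 109's `varU_Def7_1` — this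
decl is the Def 3.7 set only. [claim: Hu2025, status: under-review]
STATUS: candidate statement under adjudication (D-0012/D-0089); not asserted. -/
def varU_Def3_7 (n : ℕ) : Set (plVar n) := {x | IsBasic x}

/-- Numbered alias **`Def3_7`** = `varU_Def3_7`. [claim: Hu2025, status: under-review]
STATUS: candidate statement under adjudication (D-0012/D-0089); not asserted. -/
abbrev Def3_7 (n : ℕ) : Set (plVar n) := varU_Def3_7 n

end Literature.AlgebraicGeometry.Hu2025.Statements.S03Pluecker

end
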